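import Mathlib
import Literature.MathematicalPhysics.QuantumFieldTheory.WilsonSiteRPForm
import Literature.MathematicalPhysics.QuantumFieldTheory.LatticeGaugeProofs
import Literature.MathematicalPhysics.QuantumFieldTheory.WilsonEnergyConvexity
import Summits.Ventures.LatticeQCDFlow.TrivializingMaps.AcceptanceFootprintSharp
import Summits.Ventures.LatticeQCDFlow.Runbook.LatticeQCDFlowSanity
import HarnessLib

/-!
# THEOREM W — the witness column from reflection positivity (INPUT column of the footprint law)

HONEST FRAMING: exact (Metropolis-corrected) sampling algorithms for lattice gauge theory; figures of
merit are autocorrelation/cost numbers at stated couplings and volumes; no continuum-physics claim.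

WHAT IS PROVED (no `sorry`; torus Wilson measure `wilsonMeasure ρ β = 𝒵⁻¹ e^{-β S_W} ∏ dU` of
Wave 0, ANY real `β`, ANY compact `G` with continuous representation `ρ`, ANY `d ≥ 1`, EVEN `L`).
For a bounded measurable real observable `X` of the spatial links of the slice `x₀ = 0`
(`DependsOn X (sliceEdges d L 0)`) put `X⁽ᵗ⁾ := timeTranslate t X` (the same observable read on
the slice `x₀ = t`) and `K(t) := sliceCov ρ β X t = ⟨X X⁽ᵗ⁾⟩ - ⟨X⟩⟨X⁽ᵗ⁾⟩` (THEORY-1 §29 column).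
* §1 `mul_pow_le_of_logConvex` [elementary]: `g ≥ 0` on `[0,N]`, `g(j+1)² ≤ g j · g(j+2)`,
  `g 0, g 1 > 0` ⟹ `g 0 · (g 1 / g 0)ʲ ≤ g j` for `j ≤ N`.
* §2 `sliceCov_even_nonneg`: `0 ≤ K(2a)` (`a ≤ L/2`); `sliceCov_sq_le`: `K(a+b)² ≤ K(2a) K(2b)`
  (`a, b ≤ L/2`); `sliceCov_geometric_lower`: `v := K(0) > 0`, `c₂ := K(2) > 0` ⟹
  `v (c₂/v)ʲ ≤ K(2j)` for all `j ≤ L/2` (`K(0)` is the variance, `sliceCov_zero`). Mechanism: for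
  `a ≤ L/2` the slice-`a` copy lives on `Λ₊ ∪ {x₀ = 0, L/2}`, and on such copies the site-RP form
  of `WilsonSiteRPForm` is `⟨θX⁽ᵃ⁾ · X⁽ᵇ⁾⟩ = ⟨X⁽⁻ᵃ⁾ X⁽ᵇ⁾⟩ = ⟨X X⁽ᵃ⁺ᵇ⁾⟩` (reflection `x₀ ↦ -x₀`,
  then translation invariance); its positivity and Cauchy–Schwarz inequality (Literature,
  from Osterwalder–Seiler site RP), applied to `X - ⟨X⟩`, give (a), (b); §1 gives (c).
* §3 `Gauge.sep_le_two_mul_range_of_sliceCov` — DOCKING to the sharp footprint law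
  `|Cov_π(A,B)| ≤ 4 (1 - acc) a b` of `AcceptanceFootprintSharp` (`G = SU(n)`): a range-`r`
  proposal `Φ_* ν` (density `q`; `Φ(·)(e)` reads only links within `dist ≤ r` of `e`) with mean
  Metropolis–Hastings acceptance `≥ acc` against `π = wilsonMeasure ρ β`, `|X| ≤ C`: for every
  `j ≤ L/2` with `4 (1 - acc) C² < v (c₂/v)ʲ`, `sep ≤ 2 r` for any lower bound `sep` on `dist`
  between slice-`0` and slice-`2j` spatial links. Witnesses `A = X`, `B = X⁽²ʲ⁾` and the SIGN and
  SIZE of their covariance now come from a theorem: the INPUT shrinks to two measured numbers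
  `v, c₂`, i.e. the two-step effective mass `m₂ = -½ log (c₂/v)`. READING (THEORY-1 §29):
  `2 r ≥ sep(2j)` for every `j ≤ L/2` with `j < log (v / (4 (1 - acc) C²)) / (2 m₂)`; natural link
  metric: `sep(2j) ≍ min (2j, L - 2j)`. No cluster expansion, no small-`β` hypothesis.

NOT CLAIMED: odd separations (site reflection pairs slices at even distance; the bond-reflection
Cauchy–Schwarz form is not in `Literature/`); any lower bound on `v`, `c₂` themselves (measured
inputs — (O3) of THEORY-1 stays open as a theorem); quasi-local maps; continuum/scaling statements.

References: K. Osterwalder, E. Seiler, Ann. Phys. 110 (1978) 440, §2; E. Seiler, LNP 159 (1982)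
Ch. 2; J. Glimm, A. Jaffe, *Quantum Physics* (1987) §6.1; I. Montvay, G. Münster, *Quantum Fields
on a Lattice* (1994) §1.5.2–1.5.3, §3.2.8 (transfer matrix; site/link reflection positivity of the
Wilson action, transfer matrix for even time shifts); M. Lüscher, Commun. Math. Phys. 293 (2010) 899.
-/

noncomputable section

namespace Summit.Ventures.LatticeQCDFlow.TrivializingMaps

open MeasureTheory
open scoped ComplexOrder ComplexConjugate

namespace WitnessColumn

/-! ## §1. The geometric lower envelope of a non-negative log-convex finite sequence -/

/-- **Geometric lower envelope.** A non-negative sequence on `[0, N]` which is log-convex there,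
`g (j+1)² ≤ g j · g (j+2)`, and starts with `g 0, g 1 > 0`, dominates its initial geometric ray:
`g 0 · (g 1 / g 0)ʲ ≤ g j` for every `j ≤ N`. [elementary] -/
theorem mul_pow_le_of_logConvex {g : ℕ → ℝ} {N : ℕ} (hnn : ∀ j, j ≤ N → 0 ≤ g j)
    (hconv : ∀ j, j + 2 ≤ N → g (j + 1) ^ 2 ≤ g j * g (j + 2)) (h0 : 0 < g 0) (h1 : 0 < g 1) :
    ∀ j, j ≤ N → g 0 * (g 1 / g 0) ^ j ≤ g j := by
  have hr : 0 < g 1 / g 0 := div_pos h1 h0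
  have key : ∀ j, j + 1 ≤ N → 0 < g j ∧ g j * (g 1 / g 0) ≤ g (j + 1) := by
    intro j
    induction j with
    | zero => intro _; exact ⟨h0, by field_simp; rfl⟩
    | succ j ih =>
      intro hj
      obtain ⟨hpos, hle⟩ := ih (by omega)
      have hpos' : 0 < g (j + 1) := lt_of_lt_of_le (mul_pos hpos hr) hle
      refine ⟨hpos', le_of_mul_le_mul_left ?_ hpos'⟩
      calc g (j + 1) * (g (j + 1) * (g 1 / g 0)) = g (j + 1) ^ 2 * (g 1 / g 0) := by ring
        _ ≤ g j * g (j + 2) * (g 1 / g 0) := mul_le_mul_of_nonneg_right (hconv j (by omega)) hr.le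
        _ = g j * (g 1 / g 0) * g (j + 2) := by ring
        _ ≤ g (j + 1) * g (j + 1 + 1) := mul_le_mul_of_nonneg_right hle (hnn (j + 2) (by omega))
  intro j
  induction j with
  | zero => intro _; simp
  | succ j ih =>
    intro hj
    calc g 0 * (g 1 / g 0) ^ (j + 1) = g 0 * (g 1 / g 0) ^ j * (g 1 / g 0) := by ring
      _ ≤ g j * (g 1 / g 0) := mul_le_mul_of_nonneg_right (ih (by omega)) hr.le
      _ ≤ g (j + 1) := (key j hj).2

/-! ## §2. Slice observables of the torus Wilson theory and their reflection-positive column -/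

open Literature.MathematicalPhysics.QuantumFieldTheory
open Literature.MathematicalPhysics.QuantumFieldTheory.WilsonSiteRP

variable {d L : ℕ} [NeZero d] [NeZero L] {G : Type*}

/-- The spatial links of the time slice `x₀ = t` of the periodic torus `(ℤ/L)^d`. -/
def sliceEdges (d L : ℕ) [NeZero d] (t : ZMod L) : Set (Edge d L) := {e | e.2 ≠ 0 ∧ e.1 0 = t}

/-- Time translation of an observable by `t`: `(timeTranslate t X) U = X (x ↦ U (x + t e₀))`, so an
observable of the slice `x₀ = 0` becomes the same observable read on the slice `x₀ = t`. -/
def timeTranslate [MeasurableSpace G] (t : ZMod L) {α : Type*} (X : GaugeConfig d L G → α) :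
    GaugeConfig d L G → α :=
  X ∘ TorusTranslation.torusConfigShift (-(Pi.single 0 t : Site d L))

section Kinematics

variable [MeasurableSpace G]

omit [NeZero d] [NeZero L] in
/-- Shifting by `-v` reads the configuration at `x + v`. -/
theorem torusConfigShift_neg_apply (v : Site d L) (U : GaugeConfig d L G) (e : Edge d L) :
    TorusTranslation.torusConfigShift (-v) U e = U (e.1 + v, e.2) := by
  rw [TorusTranslation.torusConfigShift_apply, sub_neg_eq_add]

omit [NeZero d] [NeZero L] in
/-- Torus shifts compose additively. -/
theorem torusConfigShift_torusConfigShift (v w : Site d L) (U : GaugeConfig d L G) :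
    TorusTranslation.torusConfigShift v (TorusTranslation.torusConfigShift w U)
      = TorusTranslation.torusConfigShift (v + w) U := by
  funext e
  simp only [TorusTranslation.torusConfigShift_apply, sub_sub]

omit [NeZero L] in
/-- Translating by `0` does nothing. -/
theorem timeTranslate_zero {α : Type*} (X : GaugeConfig d L G → α) :
    timeTranslate (0 : ZMod L) X = X := by
  funext U; show X _ = X U; congr 1; funext e
  rw [TorusTranslation.torusConfigShift_apply, Pi.single_zero, neg_zero, sub_zero]

omit [NeZero L] in
/-- A slice-`0` observable translated by `t` is a slice-`t` observable. -/
theorem dependsOn_timeTranslate {α : Type*} {X : GaugeConfig d L G → α}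
    (hX : DependsOn X (sliceEdges d L 0)) (t : ZMod L) :
    DependsOn (timeTranslate t X) (sliceEdges d L t) := by
  intro U V hUV
  refine hX fun e he => ?_
  rw [torusConfigShift_neg_apply, torusConfigShift_neg_apply]
  refine hUV _ ⟨he.1, ?_⟩
  show (e.1 + Pi.single (0 : Fin d) t : Site d L) 0 = t
  rw [Pi.add_apply, Pi.single_eq_same, he.2, zero_add]

omit [NeZero L] in
/-- Time translates of measurable observables are measurable. -/
theorem measurable_timeTranslate {α : Type*} [MeasurableSpace α] {X : GaugeConfig d L G → α}
    (hX : Measurable X) (t : ZMod L) : Measurable (timeTranslate t X) :=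
  hX.comp (MeasurableEquiv.measurable _)

omit [NeZero L] in
/-- **Reflection identity.** The site reflection `x₀ ↦ -x₀` carries the slice-`t` copy of a
slice-`0` observable to its slice-`(-t)` copy. -/
theorem timeTranslate_negReflect [Group G] {α : Type*} {X : GaugeConfig d L G → α}
    (hX : DependsOn X (sliceEdges d L 0)) (t : ZMod L) (U : GaugeConfig d L G) :
    timeTranslate t X U.negReflect = timeTranslate (-t) X U := by
  refine hX fun e he => ?_
  obtain ⟨h2, h0⟩ := he
  rw [torusConfigShift_neg_apply, torusConfigShift_neg_apply]
  have hL : U.negReflect (e.1 + Pi.single 0 t, e.2) = U ((e.1 + Pi.single 0 t).negReflect, e.2) := by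
    simp only [GaugeConfig.negReflect, if_neg h2]
  have key : (e.1 + Pi.single 0 t).negReflect = e.1 + Pi.single 0 (-t) := by
    funext k
    by_cases hk : k = 0
    · subst hk
      rw [negReflect_apply_zero, Pi.add_apply, Pi.add_apply, Pi.single_eq_same, Pi.single_eq_same,
        h0, zero_add, zero_add]
    · rw [negReflect_apply_of_ne _ hk, Pi.add_apply, Pi.add_apply, Pi.single_eq_of_ne hk,
        Pi.single_eq_of_ne hk]
  rw [hL, key]

end Kinematics

section Column

variable [Group G] [TopologicalSpace G] [IsTopologicalGroup G] [CompactSpace G] [MeasurableSpace G]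
  [BorelSpace G] {N : ℕ} (ρ : G →* Matrix (Fin N) (Fin N) ℂ)

/-- The connected slice two-point function (the "column" of THEORY-1 §29),
`sliceCov ρ β X t = ⟨X · X⁽ᵗ⁾⟩_β - ⟨X⟩_β ⟨X⁽ᵗ⁾⟩_β`, in the covariance format of the footprint law. -/
def sliceCov (β : ℝ) (X : GaugeConfig d L G → ℝ) (t : ZMod L) : ℝ :=
  ∫ U, X U * timeTranslate t X U ∂(wilsonMeasure ρ β)
    - (∫ U, X U ∂(wilsonMeasure ρ β)) * ∫ U, timeTranslate t X U ∂(wilsonMeasure ρ β)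

/-- Translation invariance of one-point functions: `⟨X⁽ᵗ⁾⟩ = ⟨X⟩`. -/
theorem integral_timeTranslate (β : ℝ) (X : GaugeConfig d L G → ℝ) (t : ZMod L) :
    ∫ U, timeTranslate t X U ∂(wilsonMeasure ρ β) = ∫ U, X U ∂(wilsonMeasure ρ β) :=
  wilsonExpectation_comp_torusConfigShift ρ β (-(Pi.single 0 t : Site d L)) X

/-- **Translation identity.** `⟨X⁽⁻ˢ⁾ · X⁽ᵗ⁾⟩ = ⟨X · X⁽ˢ⁺ᵗ⁾⟩` (torus translation invariance of the
Wilson measure, `wilsonExpectation_comp_torusConfigShift`). -/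
theorem integral_timeTranslate_neg_mul (β : ℝ) (X : GaugeConfig d L G → ℝ) (s t : ZMod L) :
    ∫ U, timeTranslate (-s) X U * timeTranslate t X U ∂(wilsonMeasure ρ β)
      = ∫ U, X U * timeTranslate (s + t) X U ∂(wilsonMeasure ρ β) := by
  have e1 : (-(Pi.single 0 (-s)) : Site d L) = Pi.single 0 s := by rw [Pi.single_neg, neg_neg]
  have e2 : (-(Pi.single 0 (s + t)) + Pi.single 0 s : Site d L) = -(Pi.single 0 t) := by
    rw [Pi.single_add]; abel
  refine Eq.trans (integral_congr_ae (ae_of_all _ fun U => ?_))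
    (wilsonExpectation_comp_torusConfigShift ρ β (Pi.single 0 s : Site d L)
      (fun U => X U * timeTranslate (s + t) X U))
  simp only [Function.comp_apply, timeTranslate, torusConfigShift_torusConfigShift, e1, e2]

/-- At `t = 0` the column is the variance: `sliceCov ρ β X 0 = ⟨X²⟩ - ⟨X⟩²`. -/
theorem sliceCov_zero (β : ℝ) (X : GaugeConfig d L G → ℝ) :
    sliceCov ρ β X 0 = ∫ U, X U ^ 2 ∂(wilsonMeasure ρ β) - (∫ U, X U ∂(wilsonMeasure ρ β)) ^ 2 := by
  simp only [sliceCov, timeTranslate_zero, sq]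

/-- **Centring.** The column of `X` is the raw two-point function of the centred slice observable
`X - ⟨X⟩` (translation invariance of the one-point function). -/
theorem sliceCov_eq_integral_centred (hρ : Continuous ρ) (β : ℝ) {X : GaugeConfig d L G → ℝ}
    (hXm : Measurable X) {C : ℝ} (hXb : ∀ U, |X U| ≤ C) (t : ZMod L) :
    sliceCov ρ β X t
      = ∫ U, (X U - ∫ V, X V ∂(wilsonMeasure ρ β))
          * timeTranslate t (fun W => X W - ∫ V, X V ∂(wilsonMeasure ρ β)) U ∂(wilsonMeasure ρ β) := by
  haveI := isProbabilityMeasure_wilsonMeasure (d := d) (L := L) ρ hρ β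
  have hpt : ∀ U, (X U - ∫ V, X V ∂(wilsonMeasure ρ β))
        * timeTranslate t (fun W => X W - ∫ V, X V ∂(wilsonMeasure ρ β)) U
      = (X U - ∫ V, X V ∂(wilsonMeasure ρ β))
        * (timeTranslate t X U - ∫ V, X V ∂(wilsonMeasure ρ β)) - 0 := fun U => by
    simp only [timeTranslate, Function.comp_apply, sub_zero]
  simp_rw [hpt]
  rw [integral_mul_sub_mul_sub_sub _ hXm (measurable_timeTranslate hXm t) hXb (fun U => hXb _),
    sliceCov, integral_timeTranslate]
  ring

omit [Group G] [TopologicalSpace G] [IsTopologicalGroup G] [CompactSpace G] [BorelSpace G] in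
/-- A bounded measurable slice-`0` observable, translated to a slice `a ≤ L/2` and complexified, is
a half-observable of the site reflection (`x₀ = a` lies in `Λ₊ ∪ {x₀ = 0, L/2}`). -/
theorem isHalfObs_timeTranslate {X : GaugeConfig d L G → ℝ} (hXm : Measurable X) {C : ℝ}
    (hXb : ∀ U, |X U| ≤ C) (hX : DependsOn X (sliceEdges d L 0)) {a : ℕ} (ha : a ≤ L / 2) :
    IsHalfObs (fun U => ((timeTranslate (a : ZMod L) X U : ℝ) : ℂ)) := by
  refine ⟨Complex.measurable_ofReal.comp (measurable_timeTranslate hXm _),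
    ⟨C, fun U => by rw [Complex.norm_real, Real.norm_eq_abs]; exact hXb _⟩, ?_⟩
  intro U V hUV
  show ((timeTranslate (a : ZMod L) X U : ℝ) : ℂ) = ((timeTranslate (a : ZMod L) X V : ℝ) : ℂ)
  rw [dependsOn_timeTranslate hX (a : ZMod L) (fun e he => hUV e ?_)]
  obtain ⟨h2, h0⟩ := he
  have haL : a < L :=
    lt_of_le_of_lt ha (Nat.div_lt_self (Nat.pos_of_ne_zero (NeZero.ne L)) one_lt_two)
  have hval : (e.1 0).val = a := by rw [h0, ZMod.val_natCast, Nat.mod_eq_of_lt haL]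
  simp only [Finset.coe_union, Set.mem_union, Finset.mem_coe, mem_sitePosEdges, mem_sharedEdges,
    IsSitePosEdge, IsSharedEdge, if_neg h2, hval]
  by_cases h : a = 0 ∨ a = L / 2
  · exact Or.inr ⟨h2, h⟩
  · exact Or.inl ⟨by omega, by omega⟩

omit [NeZero L] [Group G] [TopologicalSpace G] [IsTopologicalGroup G] [CompactSpace G]
  [MeasurableSpace G] [BorelSpace G] in
/-- Centring preserves slice-`0` dependence. -/
theorem dependsOn_sub_const {X : GaugeConfig d L G → ℝ} (hX : DependsOn X (sliceEdges d L 0))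
    (m : ℝ) : DependsOn (fun W => X W - m) (sliceEdges d L 0) := fun U V hUV => by
  show X U - m = X V - m
  rw [hX hUV]

omit [Group G] [TopologicalSpace G] [IsTopologicalGroup G] [CompactSpace G] [BorelSpace G] in
/-- The centred observable `X - m`, translated to a slice `a ≤ L/2` and complexified, is a
half-observable of the site reflection. -/
theorem isHalfObs_timeTranslate_sub {X : GaugeConfig d L G → ℝ} (hXm : Measurable X) {C : ℝ}
    (hXb : ∀ U, |X U| ≤ C) (hX : DependsOn X (sliceEdges d L 0)) (m : ℝ) {a : ℕ} (ha : a ≤ L / 2) :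
    IsHalfObs (fun U => ((timeTranslate (a : ZMod L) (fun W => X W - m) U : ℝ) : ℂ)) :=
  isHalfObs_timeTranslate (hXm.sub measurable_const) (C := C + |m|)
    (fun U => (abs_sub _ _).trans (add_le_add (hXb U) le_rfl)) (dependsOn_sub_const hX m) ha

/-- **The site-RP form on slice observables is the two-point function.** For slice-`0` `X` and
`s, t : ℕ`, `siteRPForm (X⁽ˢ⁾) (X⁽ᵗ⁾) = ⟨X · X⁽ˢ⁺ᵗ⁾⟩` (reflection identity + translation identity). -/
theorem siteRPForm_timeTranslate (β : ℝ) {X : GaugeConfig d L G → ℝ}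
    (hX : DependsOn X (sliceEdges d L 0)) (s t : ℕ) :
    siteRPForm ρ β (fun _ : Unit => fun U => ((timeTranslate (s : ZMod L) X U : ℝ) : ℂ))
        (fun _ : Unit => fun U => ((timeTranslate (t : ZMod L) X U : ℝ) : ℂ))
      = ((∫ U, X U * timeTranslate ((s + t : ℕ) : ZMod L) X U ∂(wilsonMeasure ρ β) : ℝ) : ℂ) := by
  unfold siteRPForm
  simp only [Finset.sum_const, Finset.card_univ, Fintype.card_unit, one_smul]
  have hpt : ∀ U : GaugeConfig d L G,
      (starRingEnd ℂ) ((timeTranslate (s : ZMod L) X U.negReflect : ℝ) : ℂ)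
          * ((timeTranslate (t : ZMod L) X U : ℝ) : ℂ)
        = ((timeTranslate (-(s : ZMod L)) X U * timeTranslate (t : ZMod L) X U : ℝ) : ℂ) :=
    fun U => by rw [Complex.conj_ofReal, timeTranslate_negReflect hX, Complex.ofReal_mul]
  simp_rw [hpt]
  rw [integral_complex_ofReal, integral_timeTranslate_neg_mul, Nat.cast_add]

omit [NeZero d] in
/-- An even nonzero `L` exceeds `1`. -/
private theorem fact_one_lt_of_even (hL : Even L) : Fact (1 < L) := by
  obtain ⟨r, hr⟩ := hL; have := NeZero.ne L; exact ⟨by omega⟩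

/-- **THEOREM W (a) — positivity of the even column.** For a bounded measurable slice observable
`X`, any real `β`, `L` even and `a ≤ L/2`: `0 ≤ sliceCov ρ β X (2a) = ⟨X X⁽²ᵃ⁾⟩ - ⟨X⟩²`.
[site reflection positivity, Osterwalder–Seiler 1978 §2] -/
theorem sliceCov_even_nonneg (hL : Even L) (hρ : Continuous ρ) (β : ℝ) {X : GaugeConfig d L G → ℝ}
    (hXm : Measurable X) {C : ℝ} (hXb : ∀ U, |X U| ≤ C) (hX : DependsOn X (sliceEdges d L 0))
    {a : ℕ} (ha : a ≤ L / 2) : 0 ≤ sliceCov ρ β X ((2 * a : ℕ) : ZMod L) := by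
  haveI := fact_one_lt_of_even (L := L) hL
  set m : ℝ := ∫ V, X V ∂(wilsonMeasure ρ β) with hm
  have hpos :=
    siteRPForm_self_nonneg ρ hL hρ β (fun _ : Unit => isHalfObs_timeTranslate_sub hXm hXb hX m ha)
  rw [siteRPForm_timeTranslate ρ β (dependsOn_sub_const hX m) a a, Complex.zero_le_real] at hpos
  rw [sliceCov_eq_integral_centred ρ hρ β hXm hXb, two_mul]
  exact hpos

/-- **THEOREM W (b) — the Gram inequality of the column (log-convexity).** For `a, b ≤ L/2`:
`sliceCov (a+b)² ≤ sliceCov (2a) · sliceCov (2b)`. [Cauchy–Schwarz for the site-RP form] -/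
theorem sliceCov_sq_le (hL : Even L) (hρ : Continuous ρ) (β : ℝ) {X : GaugeConfig d L G → ℝ}
    (hXm : Measurable X) {C : ℝ} (hXb : ∀ U, |X U| ≤ C) (hX : DependsOn X (sliceEdges d L 0))
    {a b : ℕ} (ha : a ≤ L / 2) (hb : b ≤ L / 2) :
    sliceCov ρ β X ((a + b : ℕ) : ZMod L) ^ 2
      ≤ sliceCov ρ β X ((2 * a : ℕ) : ZMod L) * sliceCov ρ β X ((2 * b : ℕ) : ZMod L) := by
  haveI := fact_one_lt_of_even (L := L) hL
  set m : ℝ := ∫ V, X V ∂(wilsonMeasure ρ β) with hm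
  have hY := dependsOn_sub_const hX m
  have hcs := normSq_siteRPForm_le ρ hL hρ β
    (fun _ : Unit => isHalfObs_timeTranslate_sub hXm hXb hX m ha)
    (fun _ : Unit => isHalfObs_timeTranslate_sub hXm hXb hX m hb)
  rw [siteRPForm_timeTranslate ρ β hY a b, siteRPForm_timeTranslate ρ β hY a a,
    siteRPForm_timeTranslate ρ β hY b b, Complex.norm_real, Real.norm_eq_abs, sq_abs,
    Complex.ofReal_re, Complex.ofReal_re] at hcs
  rw [sliceCov_eq_integral_centred ρ hρ β hXm hXb, sliceCov_eq_integral_centred ρ hρ β hXm hXb,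
    sliceCov_eq_integral_centred ρ hρ β hXm hXb, two_mul, two_mul]
  exact hcs

/-- **THEOREM W (c) — the geometric lower envelope of the column.** For a bounded measurable slice
observable `X`, any real `β`, `L` even: if `v := sliceCov ρ β X 0 > 0` (variance) and
`c₂ := sliceCov ρ β X 2 > 0` (covariance at time separation `2`), then for every `j ≤ L/2`
`v · (c₂ / v)ʲ ≤ sliceCov ρ β X (2j)`: the column is bounded BELOW by the two-step effective-mass
ray. [site RP ⇒ positivity + log-convexity of `j ↦ sliceCov (2j)`, then §1] -/
theorem sliceCov_geometric_lower (hL : Even L) (hρ : Continuous ρ) (β : ℝ)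
    {X : GaugeConfig d L G → ℝ} (hXm : Measurable X) {C : ℝ} (hXb : ∀ U, |X U| ≤ C)
    (hX : DependsOn X (sliceEdges d L 0)) (hv : 0 < sliceCov ρ β X 0) (hc : 0 < sliceCov ρ β X 2)
    {j : ℕ} (hj : j ≤ L / 2) :
    sliceCov ρ β X 0 * (sliceCov ρ β X 2 / sliceCov ρ β X 0) ^ j
      ≤ sliceCov ρ β X ((2 * j : ℕ) : ZMod L) := by
  set g : ℕ → ℝ := fun i => sliceCov ρ β X ((2 * i : ℕ) : ZMod L) with hg
  have e0 : g 0 = sliceCov ρ β X 0 := by simp [hg]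
  have e1 : g 1 = sliceCov ρ β X 2 := by simp [hg]
  have hnn : ∀ i, i ≤ L / 2 → 0 ≤ g i := fun i hi => sliceCov_even_nonneg ρ hL hρ β hXm hXb hX hi
  have hconv : ∀ i, i + 2 ≤ L / 2 → g (i + 1) ^ 2 ≤ g i * g (i + 2) := fun i hi => by
    simpa only [show i + (i + 2) = 2 * (i + 1) by ring] using
      sliceCov_sq_le ρ hL hρ β hXm hXb hX (a := i) (b := i + 2) (by omega) hi
  have h := mul_pow_le_of_logConvex hnn hconv (e0 ▸ hv) (e1 ▸ hc) j hj
  rw [e0, e1] at h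
  exact h

end Column

/-! ## §3. Docking: the footprint floor of an exact flow proposal from two measured numbers -/

namespace Gauge

open Literature.MathematicalPhysics.QuantumFieldTheory.Luscher2010

variable {d L n N : ℕ} [NeZero d] [NeZero L]

/-- **THEOREM W (d) — footprint floor from the variance and one covariance** (lattice `SU(n)`,
any `β`, `L` even, any `d`, `n`, `ρ`): `π = 𝒵⁻¹ e^{-β S_W} D[U]`, `Φ_* ν` a proposal law (density `q`,
`Φ(·)(e)` reads only links within `dist`-distance `r` of `e`, mean MH acceptance `≥ acc`); `X` a
measurable slice-`0` observable, `|X| ≤ C`, `v = sliceCov 0 > 0`, `c₂ = sliceCov 2 > 0`. If for some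
`j ≤ L/2` the slices `0`, `2j` are `sep`-separated in `dist` and `4 (1 - acc) C² < v (c₂ / v)ʲ`,
then `sep ≤ 2 r` (witnesses and sign/size of their covariance from THEOREM W (c)). -/
theorem sep_le_two_mul_range_of_sliceCov (hL : Even L)
    (ρ : Matrix.specialUnitaryGroup (Fin n) ℂ →* Matrix (Fin N) (Fin N) ℂ) (hρ : Continuous ρ) (β : ℝ)
    (dist : Edge d L → Edge d L → ℕ) (hsymm : ∀ e e', dist e e' = dist e' e)
    (htri : ∀ e e' e'', dist e e'' ≤ dist e e' + dist e' e'')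
    {Φ : GaugeConfig d L (Matrix.specialUnitaryGroup (Fin n) ℂ) →
      GaugeConfig d L (Matrix.specialUnitaryGroup (Fin n) ℂ)} (hΦm : Measurable Φ)
    {q : GaugeConfig d L (Matrix.specialUnitaryGroup (Fin n) ℂ) → ℝ} (hq0 : ∀ U, 0 ≤ q U)
    (hqm : Measurable q)
    (hν : (trivialMeasure (Matrix.specialUnitaryGroup (Fin n) ℂ) d L).map Φ
      = (trivialMeasure (Matrix.specialUnitaryGroup (Fin n) ℂ) d L).withDensity
          fun U => ENNReal.ofReal (q U))
    {Nb : Edge d L → Set (Edge d L)} (hΦ : ∀ e, DependsOn (fun W => Φ W e) (Nb e)) {r : ℕ}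
    (hN : ∀ e, ∀ e' ∈ Nb e, dist e e' ≤ r) {acc : ℝ}
    (hacc : acc ≤ ∫ U, ∫ U', min
        (Real.exp (-(β * wilsonAction ρ U)) / (partitionFn fun W :
          GaugeConfig d L (Matrix.specialUnitaryGroup (Fin n) ℂ) => β * wilsonAction ρ W).toReal * q U')
        (Real.exp (-(β * wilsonAction ρ U')) / (partitionFn fun W :
          GaugeConfig d L (Matrix.specialUnitaryGroup (Fin n) ℂ) => β * wilsonAction ρ W).toReal * q U)
        ∂(trivialMeasure (Matrix.specialUnitaryGroup (Fin n) ℂ) d L)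
        ∂(trivialMeasure (Matrix.specialUnitaryGroup (Fin n) ℂ) d L))
    {X : GaugeConfig d L (Matrix.specialUnitaryGroup (Fin n) ℂ) → ℝ} (hXm : Measurable X) {C : ℝ}
    (hXb : ∀ U, |X U| ≤ C) (hX : DependsOn X (sliceEdges d L 0))
    (hv : 0 < sliceCov ρ β X 0) (hc : 0 < sliceCov ρ β X 2) {j : ℕ} (hj : j ≤ L / 2) {sep : ℕ}
    (hfar : ∀ e ∈ sliceEdges d L 0, ∀ e' ∈ sliceEdges d L ((2 * j : ℕ) : ZMod L), sep ≤ dist e e')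
    (hacc_j : 4 * (1 - acc) * (C * C)
      < sliceCov ρ β X 0 * (sliceCov ρ β X 2 / sliceCov ρ β X 0) ^ j) :
    sep ≤ 2 * r := by
  have hS : Continuous fun U : GaugeConfig d L (Matrix.specialUnitaryGroup (Fin n) ℂ) =>
      β * wilsonAction ρ U := continuous_const.mul (continuous_wilsonAction_of_continuous ρ hρ)
  have hπ : boltzmannMeasure (fun U : GaugeConfig d L (Matrix.specialUnitaryGroup (Fin n) ℂ) =>
      β * wilsonAction ρ U) = wilsonMeasure ρ β := Runbook.boltzmannMeasure_wilson_eq ρ β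
  refine Gauge.sep_le_two_mul_range_of_meanAccept_four hS dist hsymm htri hΦm hq0 hqm hν hΦ hN hacc
    hXm (measurable_timeTranslate hXm _) hXb (fun U => hXb _) hX (dependsOn_timeTranslate hX _) hfar
    (m := sliceCov ρ β X 0 * (sliceCov ρ β X 2 / sliceCov ρ β X 0) ^ j) ?_ hacc_j
  rw [hπ]
  exact (sliceCov_geometric_lower ρ hL hρ β hXm hXb hX hv hc hj).trans (le_abs_self _)

end Gauge

end WitnessColumn

end Summit.Ventures.LatticeQCDFlow.TrivializingMaps

end
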